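import Summits.BirchSwinnertonDyer.BirchSwinnertonDyer.Theorems.ClassRecordThreeEulerHalvesAtThreeCartanCoverHeckeDatum
import HarnessLib

/-!
# Hecke operators preserve parabolic-null cochains; `3`-torsion eigen-cochains reduce to `𝔽₃`-valued ones — kernel glue for (LIFT′)

Helper-only file (bsd-idea-10 g20, lens = transfer) for crux `EulerHalvesAtThree` (stmt-BirchSwinnertonDyer-19109) ∕ the Galois leaf (OBS)
`CartanCover.Charext.NoModThreePeriodCharacterExtension` of the child node `CartanOnePlaceDegreeLawAtThree` (stmt-…-24801). It supplies two pieces of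
the in-tree glue by which the print socket (LIFT′) `CartanCarayol.CuspidalEigenCochainLiftPrimeToCartanPlaceAtThree` (`…CartanCarayolLift`, p742701) is to be
DISCHARGED from Literature facts of Eichler–Shimura ∕ signature ∕ Jacquet–Langlands type (typer cell, announced 2026-08-29) along the sibling's chain
`TameQuarticManinParity.modThreePeriodEigenclassLiftsToNewform_proof` (Deligne–Serre `deligneSerre_lifting_of_free` on the lattice `L = Hom_par(Γ′, ℤ)` of
additive parabolic-null integral cochains of the cover group `Γ′ = ι(O₀'¹)`):

* §1 (generic `HeckeDatum`, any group): `σ (γ ^ n) = (σ γ) ^ n`, `T χ (γ ^ n) = n • T χ γ` for additive `χ`, and the ORBIT-LENGTH IDENTITY behind stability: with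
  `N = orderOf (σ γ)` (finite index set) every representative normalises `γ ^ N` into `Γ` and `N • (T χ)(γ) = (T χ)(γ ^ N) = Σ_i χ(α_i γ^N α_i⁻¹)`; hence
  `heckeOp_nsmul_apply_eq_zero`: if `χ` kills every `α_i γ^n α_i⁻¹ ∈ Γ` (`n > 0`) then `N • (T χ)(γ) = 0` for some `N > 0`, and `(T χ)(γ) = 0` when the
  coefficient group has no `ℕ`-torsion (`ℤ`, `ℝ`, `ℂ`: the lattice `L` and the real period cochains of Shimura's Thm. 8.4).
* §2 (`𝔾 = GL₂`): **`T_ℓ` PRESERVES PARABOLIC-NULL ADDITIVE COCHAINS** with torsion-free coefficients (`heckeOp_apply_eq_zero_of_isParabolic`): conjugates of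
  powers of a parabolic element are parabolic (`Matrix.GeneralLinearGroup.IsParabolic.pow`, `isParabolic_conj_iff`). This is the `T_ℓ`-stability of
  `L = Hom_par(Γ′, ℤ)` (and of `Hom_par(Γ′, ℝ) ≅ S₂(Γ′)`) needed before Deligne–Serre can be run on `L`; no Eichler–Shimura input is used.
* §3 (reduction of coefficients): `T` commutes with post-composition by additive maps (`heckeOp_comp_addMonoidHom`), and a non-zero element of a `3`-torsion
  abelian group is detected by an additive map to `ZMod 3` (`exists_addMonoidHom_zmod_three_apply_ne_zero`; `A` is an `𝔽₃`-vector space); so the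
  `A`-valued package of (LIFT′) ∕ (EIG′) (additive, `3`-torsion, non-zero, null on finite-order and parabolic elements, `T_ℓ`-eigen) yields a `ZMod 3`-valued one
  with the same clauses (`exists_zmod_three_cochain_of_package`), which is the shape the signature fact `Hom_par(Γ′, ℤ) ↠ Hom_par(Γ′, ℤ∕3)` consumes.

THEOREMS ONLY (no `def`, no named fact, no `sorry`); nothing here is specific to a curve. No crux ∕ stub ∕ summit statement is proved; BSD is proved for no curve.
[cite: ShimuraIATAF1971, §3.1 (coset permutations), §8.3 (Hecke operators on cohomology)] [cite: DeligneSerre1974, Lemme 6.11]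
-/

set_option linter.dupNamespace false
set_option autoImplicit false

noncomputable section

open scoped Classical MatrixGroups

namespace Summit.BirchSwinnertonDyer.BirchSwinnertonDyer.Theorems.CartanCarayol

open Summit.BirchSwinnertonDyer.BirchSwinnertonDyer.Theorems.CartanCover.Charext
open Summit.BirchSwinnertonDyer.BirchSwinnertonDyer.Theorems.CartanCover.Charext.InertHecke

/-! ## §1 Powers, and the orbit-length identity `N • (T χ)(γ) = (T χ)(γ ^ N)` -/

section Generic

variable {𝔾 : Type*} [Group 𝔾] {Γ : Subgroup 𝔾} {ι : Type*} (H : HeckeDatum Γ ι)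

/-- the coset permutation of a power is the power of the coset permutation (`σ` is an anti-homomorphism, `HeckeDatum.σ_mul`). [folklore] -/
theorem heckeσ_pow (γ : Γ) (n : ℕ) : H.σ (γ ^ n) = H.σ γ ^ n := by
  induction n with
  | zero =>
    ext i
    rw [pow_zero, pow_zero, H.σ_one, Equiv.Perm.one_apply]
  | succ n ih =>
    ext i
    rw [pow_succ, H.σ_mul, ih, ← Equiv.Perm.mul_apply, ← pow_succ']

/-- with `N = orderOf (σ γ)`, every representative normalises `γ ^ N` into `Γ`. [folklore] -/
theorem hecke_conj_pow_orderOf_mem (γ : Γ) (i : ι) :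
    H.α i * ((γ : 𝔾) ^ orderOf (H.σ γ)) * (H.α i)⁻¹ ∈ Γ := by
  have h := H.mem (γ ^ orderOf (H.σ γ)) i
  rw [heckeσ_pow, pow_orderOf_eq_one, Equiv.Perm.one_apply, Subgroup.coe_pow] at h
  exact h

variable {A : Type*} [AddCommGroup A] [Fintype ι]

/-- an additive cochain has additive Hecke image, so `(T χ)(1) = 0`. [folklore] -/
theorem heckeOp_one (χ : Γ → A) (hχ : ∀ a b : Γ, χ (a * b) = χ a + χ b) : H.op χ 1 = 0 := by
  have h := H.op_mul χ hχ 1 1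
  rw [mul_one] at h
  exact left_eq_add.mp h

/-- `(T χ)(γ ^ n) = n • (T χ)(γ)` for an additive cochain `χ` ((T1) `HeckeDatum.op_mul`). [folklore] -/
theorem heckeOp_pow (χ : Γ → A) (hχ : ∀ a b : Γ, χ (a * b) = χ a + χ b) (γ : Γ) (n : ℕ) :
    H.op χ (γ ^ n) = n • H.op χ γ := by
  induction n with
  | zero => rw [pow_zero, zero_smul, heckeOp_one H χ hχ]
  | succ n ih => rw [pow_succ, H.op_mul χ hχ, ih, add_smul, one_smul]

/-- **the orbit-length identity**: `N • (T χ)(γ) = Σ_i χ(α_i γ^N α_i⁻¹)` with `N = orderOf (σ γ)`. [cite: ShimuraIATAF1971, §3.1] -/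
theorem heckeOp_orderOf_nsmul_apply (χ : Γ → A) (hχ : ∀ a b : Γ, χ (a * b) = χ a + χ b) (γ : Γ) :
    orderOf (H.σ γ) • H.op χ γ =
      ∑ i, χ ⟨H.α i * ((γ : 𝔾) ^ orderOf (H.σ γ)) * (H.α i)⁻¹, hecke_conj_pow_orderOf_mem H γ i⟩ := by
  have hβ : ∀ i, H.α i * ((γ ^ orderOf (H.σ γ) : Γ) : 𝔾) * (H.α i)⁻¹ ∈ Γ := fun i ↦ by
    rw [Subgroup.coe_pow]; exact hecke_conj_pow_orderOf_mem H γ i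
  rw [← heckeOp_pow H χ hχ, H.op_apply_of_normalised χ _ hβ]
  exact Finset.sum_congr rfl fun i _ ↦ congrArg χ (Subtype.ext rfl)

/-- **vanishing up to the orbit length**: if the additive cochain `χ` kills every element of `Γ` of the form `α_i γ^n α_i⁻¹` (`n > 0`), then
`N • (T χ)(γ) = 0` for some `N > 0` (namely `N = orderOf (σ γ)`). [folklore] -/
theorem heckeOp_nsmul_apply_eq_zero (χ : Γ → A) (hχ : ∀ a b : Γ, χ (a * b) = χ a + χ b) (γ : Γ)
    (hkill : ∀ (n : ℕ) (i : ι) (h : H.α i * ((γ : 𝔾) ^ n) * (H.α i)⁻¹ ∈ Γ), 0 < n → χ ⟨_, h⟩ = 0) :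
    ∃ N : ℕ, 0 < N ∧ N • H.op χ γ = 0 := by
  refine ⟨orderOf (H.σ γ), orderOf_pos _, ?_⟩
  rw [heckeOp_orderOf_nsmul_apply H χ hχ γ]
  exact Finset.sum_eq_zero fun i _ ↦ hkill _ i _ (orderOf_pos _)

/-- … and `(T χ)(γ) = 0` outright when the coefficient group has no `ℕ`-torsion (`ℤ`, `ℝ`, `ℂ`). [folklore] -/
theorem heckeOp_apply_eq_zero_of_conj_pow [NoZeroSMulDivisors ℕ A] (χ : Γ → A) (hχ : ∀ a b : Γ, χ (a * b) = χ a + χ b) (γ : Γ)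
    (hkill : ∀ (n : ℕ) (i : ι) (h : H.α i * ((γ : 𝔾) ^ n) * (H.α i)⁻¹ ∈ Γ), 0 < n → χ ⟨_, h⟩ = 0) :
    H.op χ γ = 0 := by
  obtain ⟨N, hN, h⟩ := heckeOp_nsmul_apply_eq_zero H χ hχ γ hkill
  rcases smul_eq_zero.mp h with h0 | h0
  · exact absurd h0 hN.ne'
  · exact h0

/-! ## §3 (first half) `T` commutes with a change of coefficients -/

/-- `T (φ ∘ χ) = φ ∘ T χ` for an additive map of coefficients `φ`. [folklore] -/
theorem heckeOp_comp_addMonoidHom {B : Type*} [AddCommGroup B] (φ : A →+ B) (χ : Γ → A) (γ : Γ) :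
    H.op (φ ∘ χ) γ = φ (H.op χ γ) := by
  rw [H.op_apply, H.op_apply, map_sum]
  rfl

/-- an eigen-relation `T χ = a • χ` survives a change of coefficients. [folklore] -/
theorem heckeOp_comp_eq_smul_of_eq_smul {B : Type*} [AddCommGroup B] (φ : A →+ B) (χ : Γ → A) (a : ℤ)
    (heig : ∀ x, H.op χ x = a • χ x) (x : Γ) : H.op (φ ∘ χ) x = a • (φ ∘ χ) x := by
  rw [heckeOp_comp_addMonoidHom, heig, map_zsmul]
  rfl

end Generic

/-! ## §2 `T_ℓ` preserves parabolic-null additive cochains (torsion-free coefficients) -/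

section Parabolic

variable {K : Type*} [Field K] [CharZero K] {Γ : Subgroup (GL (Fin 2) K)} {ι : Type*} (H : HeckeDatum Γ ι)
  {A : Type*} [AddCommGroup A] [Fintype ι]

/-- **`T` PRESERVES PARABOLIC-NULL ADDITIVE COCHAINS** (coefficients without `ℕ`-torsion): if `χ : Γ → A` is additive and vanishes on every parabolic element of
`Γ`, so does `T χ` — for every Hecke datum on `Γ ≤ GL₂(K)`, `char K = 0`. (For each parabolic `γ`, `N • (T χ)(γ) = Σ_i χ(α_i γ^N α_i⁻¹)` with `N` the
order of the coset permutation, and conjugates of non-trivial powers of a parabolic element are parabolic.) This is the `T_ℓ`-stability of `Hom_par(Γ′, ℤ)` and of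
`Hom_par(Γ′, ℝ)`. [cite: ShimuraIATAF1971, §8.3 (Hecke operators on parabolic cohomology)] -/
theorem heckeOp_apply_eq_zero_of_isParabolic [NoZeroSMulDivisors ℕ A] (χ : Γ → A) (hχ : ∀ a b : Γ, χ (a * b) = χ a + χ b)
    (hpar : ∀ β : Γ, Matrix.GeneralLinearGroup.IsParabolic (β : GL (Fin 2) K) → χ β = 0) (γ : Γ)
    (hγ : Matrix.GeneralLinearGroup.IsParabolic (γ : GL (Fin 2) K)) : H.op χ γ = 0 :=
  heckeOp_apply_eq_zero_of_conj_pow H χ hχ γ fun _ i _ hn ↦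
    hpar _ ((Matrix.GeneralLinearGroup.isParabolic_conj_iff (H.α i) _).mpr (hγ.pow hn.ne'))

/-- the same, packaged as stability of the class of additive parabolic-null cochains under `T`. [folklore] -/
theorem heckeOp_parabolicNull [NoZeroSMulDivisors ℕ A] (χ : Γ → A) (hχ : ∀ a b : Γ, χ (a * b) = χ a + χ b)
    (hpar : ∀ β : Γ, Matrix.GeneralLinearGroup.IsParabolic (β : GL (Fin 2) K) → χ β = 0) :
    (∀ a b : Γ, H.op χ (a * b) = H.op χ a + H.op χ b) ∧
      ∀ β : Γ, Matrix.GeneralLinearGroup.IsParabolic (β : GL (Fin 2) K) → H.op χ β = 0 :=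
  ⟨H.op_mul χ hχ, heckeOp_apply_eq_zero_of_isParabolic H χ hχ hpar⟩

end Parabolic

/-! ## §3 (second half) `3`-torsion coefficients reduce to `ZMod 3` -/

section Reduction

/-- **a non-zero element of a `3`-torsion abelian group is seen by an additive map to `ZMod 3`** (`A` is an `𝔽₃`-vector space; linear functionals separate
points). [folklore] -/
theorem exists_addMonoidHom_zmod_three_apply_ne_zero {A : Type*} [AddCommGroup A] (h3 : ∀ a : A, 3 • a = 0) {a : A} (ha : a ≠ 0) :
    ∃ φ : A →+ ZMod 3, φ a ≠ 0 := by
  letI : Module (ZMod 3) A := AddCommGroup.zmodModule h3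
  by_contra hφ
  refine ha ((Module.forall_dual_apply_eq_zero_iff (ZMod 3) a).mp fun ψ ↦ ?_)
  by_contra hψ
  exact hφ ⟨ψ.toAddMonoidHom, hψ⟩

variable {𝔾 : Type*} [Group 𝔾] {Γ : Subgroup 𝔾} {A : Type*} [AddCommGroup A]

/-- **REDUCTION OF THE COEFFICIENTS OF AN EIGEN-COCHAIN PACKAGE TO `ZMod 3`.** An additive, `3`-torsion, non-zero cochain `χ : Γ → A`, null on a prescribed set
of elements (e.g. the finite-order and the parabolic ones) and `T`-eigen for a prescribed family of Hecke data (indexed by `ℓ ∈ P`, eigenvalues `a ℓ`), gives —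
after composing with a suitable additive `φ : A → ZMod 3` — a `ZMod 3`-valued cochain with the same clauses. This is the passage from the `A`-valued output of
(EIG′) ∕ input of (LIFT′) to the `𝔽₃`-valued cochains of the signature fact `Hom_par(Γ′, ℤ) ↠ Hom_par(Γ′, ℤ∕3)`. [folklore] -/
theorem exists_zmod_three_cochain_of_package (χ : Γ → A) (hadd : ∀ a b : Γ, χ (a * b) = χ a + χ b) (h3 : ∀ x, 3 • χ x = 0)
    (hne : ∃ x, χ x ≠ 0) (Z : Set Γ) (hnull : ∀ x ∈ Z, χ x = 0)
    {P : Set ℕ} {ι : ℕ → Type*} [∀ ℓ, Fintype (ι ℓ)] (T : ∀ ℓ, HeckeDatum Γ (ι ℓ)) (a : ℕ → ℤ)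
    (heig : ∀ ℓ ∈ P, ∀ x, (T ℓ).op χ x = a ℓ • χ x) :
    ∃ ψ : Γ → ZMod 3, (∀ a b : Γ, ψ (a * b) = ψ a + ψ b) ∧ (∃ x, ψ x ≠ 0) ∧ (∀ x ∈ Z, ψ x = 0) ∧
      ∀ ℓ ∈ P, ∀ x, (T ℓ).op ψ x = a ℓ • ψ x := by
  obtain ⟨x₀, hx₀⟩ := hne
  -- the subgroup generated by the values is `3`-torsion; work in `A` itself with the functional chosen at `χ x₀`
  have h3A : ∀ b : AddSubgroup.closure (Set.range χ), 3 • b = 0 := by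
    rintro ⟨b, hb⟩
    apply Subtype.ext
    simp only [AddSubgroup.coe_nsmul, AddSubgroup.coe_zero]
    induction hb using AddSubgroup.closure_induction with
    | mem y hy => obtain ⟨x, rfl⟩ := hy; exact h3 x
    | zero => rw [smul_zero]
    | add y z _ _ hy hz => rw [smul_add, hy, hz, add_zero]
    | neg y _ hy => rw [smul_neg, hy, neg_zero]
  set χ' : Γ → AddSubgroup.closure (Set.range χ) := fun x ↦ ⟨χ x, AddSubgroup.subset_closure ⟨x, rfl⟩⟩ with hχ'
  have hx₀' : χ' x₀ ≠ 0 := fun h ↦ hx₀ (by simpa [hχ'] using congrArg Subtype.val h)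
  obtain ⟨φ₀, hφ₀⟩ := exists_addMonoidHom_zmod_three_apply_ne_zero h3A hx₀'
  -- `φ := φ₀ ∘ (corestriction)`, realised as `φ₀ ∘ χ'`; all clauses transfer
  refine ⟨fun x ↦ φ₀ (χ' x), fun u v ↦ ?_, ⟨x₀, hφ₀⟩, fun x hx ↦ ?_, fun ℓ hℓ x ↦ ?_⟩
  · have e : χ' (u * v) = χ' u + χ' v := Subtype.ext (by simp [hχ', hadd])
    show φ₀ (χ' (u * v)) = φ₀ (χ' u) + φ₀ (χ' v)
    rw [e, map_add]
  · have e : χ' x = 0 := Subtype.ext (by simp [hχ', hnull x hx])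
    show φ₀ (χ' x) = 0
    rw [e, map_zero]
  · have hadd' : ∀ u v : Γ, χ' (u * v) = χ' u + χ' v := fun u v ↦ Subtype.ext (by simp [hχ', hadd])
    have heig' : ∀ y, (T ℓ).op χ' y = a ℓ • χ' y := fun y ↦ by
      apply Subtype.ext
      have e := heig ℓ hℓ y
      rw [(T ℓ).op_apply] at e ⊢
      simp only [hχ', AddSubgroup.val_finsetSum, AddSubgroup.coe_zsmul] at e ⊢
      exact e
    have := heckeOp_comp_eq_smul_of_eq_smul (T ℓ) φ₀ χ' (a ℓ) heig' x
    simpa [Function.comp_def] using this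

end Reduction

end Summit.BirchSwinnertonDyer.BirchSwinnertonDyer.Theorems.CartanCarayol

end
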